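import Summits.CriticalPhenomena.SAWScalingLimit.Theorems.SAWLoopFugacityFlowIsingBoundaryRatioSideCrossSeparation
import HarnessLib

/-!
# Rough half-annulus RSW for the mesh graph (stub `stub_roughHalfAnnulusRSWMesh`, line `fk-anchor-transfer`,
crux `IsingBoundaryRatio`, stmt-CriticalPhenomena-10650) — status BLOCKED; reduction to two instances of
Chelkak–Duminil-Copin–Hongler 2016, Thm 1.1

The registered stub `stub_roughHalfAnnulusRSWMesh : RoughHalfAnnulusRSWMeshOf AnnPathSepG` asks, for the
mesh graph `Ω_δ` of a Dobrushin domain `(D; a, b)` near the rough marked prime end `a = φ(0)`, for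
(1) a lower bound `c > 0`, under the FREE critical FK-Ising measure of the local graph `⟨U⟩` spanned by
the edges touching the lattice conformal half-annulus `Ann = φ({ρ < |w| < Mρ})`, on the probability of
the guarded open-path separation event `AnnPathSepG` (some open walk inside `Ann` meets every walk from
the inside `In` to the outside, required only when such a walk exists), and (2) an upper bound `1 - c`
on the open radial crossing `AnnCross` under the measure of `⟨U⟩` with everything off `Ann` wired.

1. NOT PROVED. The printed input is Chelkak–Duminil-Copin–Hongler 2016 Thm 1.1 (landed as the named
   fact `Literature.Probability.LatticeModels.fkIsing_topologicalRectangle_crossingBounds`, file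
   `Literature/Probability/LatticeModels/FKIsingTopologicalRectangleCrossing.lean`, with the discrete
   topological rectangle vocabulary `DiscreteRect.*`): crossing bounds in terms of the discrete extremal
   length only, free/wired extremal boundary conditions. Its two instances needed here are named in
   `…IsingBoundaryRatioRSWMeshDefs.lean`: `HalfAnnulusSideCrossingBound` (open crossing between the two
   ROUGH SIDES of the window `[M^{1/4}ρ, M^{3/4}ρ]` of the annulus, free local measure, `≥ c`) and
   `HalfAnnulusRimCrossingBound` (= clause (2)). What separates them from the named fact: the
   identification of the lattice window (main component, holes filled) as a `DiscreteRect.IsRect` with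
   the rough sides / the rims inside the marked arcs (boundary cycle of `Ω_δ` near the rough arcs of `∂D`),
   and the bound on its discrete extremal length in terms of `M` for small `δ` (Chelkak's toolbox,
   Prop. 6.2 / Cor. 6.3, for the polygonal representation, plus a continuum extremal-length comparison
   with the chart half-annulus).
2. PROVED HERE and in `…SideCrossSeparation.lean`: the planar topology (`annSideCrossSeparation`: an open
   side-to-side crossing of the window is an `AnnPathSep` separator, for small `δ`; the window margin is
   necessary), the passage from the link guard `AnnLink` to the canonical volumes given the one
   ball-component lemma `ChartDiscOneComponent` (TARGET, lattice topology; `forall_mem_of_annLink`), and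
   the assembly `roughHalfAnnulusRSWMesh_of_crossingBounds : ChartDiscOneComponent →
   HalfAnnulusSideCrossingBound → HalfAnnulusRimCrossingBound → RoughHalfAnnulusRSWMeshOf AnnPathSepG`.
3. NOT REFUTED: the extremal wiring `Annᶜ` (inside wired WITH the outside) is covered by CDH16's "any
   boundary conditions"; lakes of `Ω_δ` do not exist (a lattice cycle in `closure D` bounds cells of `D`,
   filled by the largest component); the guard `AnnLink` makes clause (1) vacuous exactly for the finite
   volumes missing the ball-component of the annulus; `ρ₀` depends on `ε` only through
   `φ({|w| < Mρ₀}) ⊆ B(a, ε)`; corner defects of `∂D` at `φ(±ρ)`, `φ(±Mρ)` are why the crossing event is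
   windowed.

References: Chelkak, Duminil-Copin, Hongler, EJP 21 (2016), Thm 1.1, Rem. 2.2, arXiv:1312.7785
[`ChelkakDuminilCopinHongler2016`]; Chelkak, *Robust discrete complex analysis: a toolbox*, Ann. Probab. 44
(2016), §6 [`Chelkak2016`].
-/

noncomputable section

open scoped Classical Topology
open Filter Set Metric SimpleGraph MeasureTheory
open Literature.Probability.LatticeModels Literature.Probability.RandomPlanarGeometry
open Literature.Probability.Percolation (BondConfig)
open UpperHalfPlane (upperHalfPlaneSet)

namespace Summit.CriticalPhenomena.SAWScalingLimit.Theorems.IsingBoundaryRatio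

/-- `M ↦ M^{1/4}` exceeds `1` past `1`. [folklore] -/
theorem one_lt_sqrt_sqrt {M : ℝ} (hM : 1 < M) : 1 < Real.sqrt (Real.sqrt M) := by
  rw [Real.lt_sqrt zero_le_one, one_pow, Real.lt_sqrt zero_le_one, one_pow]
  exact hM

/-- The window `[M^{1/4} ρ, M^{3/4} ρ]` sits strictly inside `(ρ, Mρ)`. [folklore] -/
theorem window_bounds {M ρ : ℝ} (hM : 1 < M) (hρ : 0 < ρ) :
    ρ < Real.sqrt (Real.sqrt M) * ρ ∧
      Real.sqrt (Real.sqrt M) * ρ ≤ M * ρ / Real.sqrt (Real.sqrt M) ∧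
      M * ρ / Real.sqrt (Real.sqrt M) < M * ρ := by
  set s := Real.sqrt (Real.sqrt M) with hs
  have hs1 : 1 < s := one_lt_sqrt_sqrt hM
  have hs0 : 0 < s := one_pos.trans hs1
  have hM0 : 0 < M := one_pos.trans hM
  have hss : s * s = Real.sqrt M := by rw [hs, Real.mul_self_sqrt (Real.sqrt_nonneg M)]
  have hsqM : Real.sqrt M ≤ M := by
    rw [Real.sqrt_le_left hM0.le]
    nlinarith
  refine ⟨by nlinarith, ?_, ?_⟩
  · rw [le_div_iff₀ hs0]
    calc s * ρ * s = (s * s) * ρ := by ring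
      _ ≤ M * ρ := by rw [hss]; exact mul_le_mul_of_nonneg_right hsqM hρ.le
  · rw [div_lt_iff₀ hs0]
    nlinarith [mul_pos hM0 hρ]

/-- **From the link guard to the canonical volume.** If `Λ` agrees locally with `Ω_δ` in `B(a, ε)`, some
walk of `H = Ω_δ|_Λ` leaves `annIn` (so `Λ` holds a vertex of `Ω_δ` of chart radius `≤ ρ`), and any two
vertices of `Ω_δ` of chart radius `< R`, `Mρ ≤ R`, are joined inside `B(a, ε)` (`ChartDiscOneComponent`
at scale `R`), then `Λ` contains every vertex of `Ω_δ` of chart radius `< Mρ` (walk along the joining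
walk: local agreement keeps each next vertex in `Λ`). [folklore] -/
theorem forall_mem_of_annLink {D : DobrushinDomain} {φ : ConformalEquiv upperHalfPlaneSet D.carrier}
    {M ε δ ρ R : ℝ} (hMR : M * ρ ≤ R) (hρM : ρ < M * ρ) {Λ : Finset (Site 2)}
    (hLA : LocalAgreement D.carrier (D.pt 0) ε δ (discreteDomainGraph D.carrier δ) Λ)
    (hone : ∀ x ∈ meshDomain D.carrier δ, ∀ y ∈ meshDomain D.carrier δ,
      ‖φ.symm (meshPoint δ x)‖ < R → ‖φ.symm (meshPoint δ y)‖ < R →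
        ∃ w : (discreteDomainGraph D.carrier δ).Walk x y, ∀ z ∈ w.support, meshPoint δ z ∈ Metric.ball (D.pt 0) ε)
    (hlink : AnnLink ((discreteDomainGraph D.carrier δ).comap (Subtype.val : Λ → Site 2)) (annIn D φ ε δ ρ Λ)
      (annBody D φ M ε δ ρ Λ)) :
    ∀ x ∈ meshDomain D.carrier δ, ‖φ.symm (meshPoint δ x)‖ < M * ρ → x ∈ Λ := by
  obtain ⟨a₀, b₀, q, ha₀, hb₀⟩ := hlink
  -- `q` is not trivial, so `a₀` is a genuine vertex of `Ω_δ`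
  have ha₀D : a₀.1 ∈ meshDomain D.carrier δ := by
    cases q with
    | nil => exact absurd (Or.inl ha₀) hb₀
    | cons h _ => exact (discreteDomainGraph_adj_iff.1 h).2.1
  intro x hx hxr
  obtain ⟨w, hw⟩ := hone a₀.1 ha₀D x hx (ha₀.2.trans_lt (hρM.trans_le hMR)) (hxr.trans_le hMR)
  -- every vertex of `w` lies in `Λ`
  suffices key : ∀ {y z : Site 2} (w : (discreteDomainGraph D.carrier δ).Walk y z),
      y ∈ Λ → (∀ t ∈ w.support, meshPoint δ t ∈ Metric.ball (D.pt 0) ε) → z ∈ Λ from key w a₀.2 hw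
  intro y z w
  induction w with
  | nil => exact fun hy _ => hy
  | @cons c d e hcd w' ih =>
    intro hc hball
    have hd : d ∈ Λ := (hLA c hc (hball c (by simp)) d).2 hcd
    exact ih hd fun t ht => hball t (by simp [ht])

/-- **The mesh-graph RSW residual from its four pieces**: separation of the inside from the outside by
side-to-side crossings of the window `[M^{1/4} ρ, M^{3/4} ρ]` (`AnnSideCrossSeparation`), the one
ball-component lemma turning the link guard into the canonical volume (`ChartDiscOneComponent`), the
lower bound for side-to-side crossings under the free local measure in the canonical volumes
(`HalfAnnulusSideCrossingBound`), and the upper bound for rim-to-rim crossings under the wired local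
measure (`HalfAnnulusRimCrossingBound`); the constant is `min c₂ c₃ 1`, the scale threshold the least of
the four, and when no walk joins the inside to the outside the guarded event `AnnPathSepG` is sure.
[folklore] -/
theorem roughHalfAnnulusRSWMesh_of_bounds (h1 : AnnSideCrossSeparation) (h4 : ChartDiscOneComponent)
    (h2 : HalfAnnulusSideCrossingBound) (h3 : HalfAnnulusRimCrossingBound) :
    RoughHalfAnnulusRSWMeshOf AnnPathSepG := by
  intro D φ hφ M hM
  have hM0 : 0 < M := one_pos.trans hM
  obtain ⟨c₂, hc₂, h2'⟩ := h2 D φ hφ M hM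
  obtain ⟨c₃, hc₃, h3'⟩ := h3 D φ hφ M hM
  refine ⟨min (min c₂ c₃) 1, lt_min (lt_min hc₂ hc₃) one_pos, fun ε hε => ?_⟩
  obtain ⟨ρ₁, hρ₁, h1'⟩ := h1 D φ hφ M hM ε hε
  obtain ⟨ρ₂, hρ₂, h2''⟩ := h2' ε hε
  obtain ⟨ρ₃, hρ₃, h3''⟩ := h3' ε hε
  obtain ⟨R₀, hR₀, h4'⟩ := h4 D φ hφ ε hε
  refine ⟨min (min ρ₁ (R₀ / M)) (min ρ₂ ρ₃),
    lt_min (lt_min hρ₁ (div_pos hR₀ hM0)) (lt_min hρ₂ hρ₃), fun ρ hρ hρlt => ?_⟩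
  have hρ1 : ρ < ρ₁ := hρlt.trans_le ((min_le_left _ _).trans (min_le_left _ _))
  have hρR : M * ρ < R₀ := by
    have := hρlt.trans_le ((min_le_left _ _).trans (min_le_right _ _))
    rwa [lt_div_iff₀ hM0, mul_comm] at this
  have hρ2 : ρ < ρ₂ := hρlt.trans_le ((min_le_right _ _).trans (min_le_left _ _))
  have hρ3 : ρ < ρ₃ := hρlt.trans_le ((min_le_right _ _).trans (min_le_right _ _))
  have hρM : ρ < M * ρ := lt_mul_left hρ hM
  obtain ⟨hr1, hr12, hr2⟩ := window_bounds hM hρ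
  have hp : (1 - Real.exp (-2 * criticalBetaTwo)) ∈ Set.Icc (0 : ℝ) 1 :=
    fkIsingParam_mem_Icc criticalBetaTwo_pos.le
  filter_upwards [h1' ρ _ _ hρ hρ1 hr1 hr12 hr2, h2'' ρ hρ hρ2, h3'' ρ hρ hρ3,
    h4' (M * ρ) (mul_pos hM0 hρ) hρR] with δ hδ1 hδ2 hδ3 hδ4 Λ hLA
  intro H In Ann
  haveI : IsProbabilityMeasure (rcMeasure (fromEdgeSet (↑(annEdgeFinset H Ann) : Set (Sym2 Λ)))
      (1 - Real.exp (-2 * criticalBetaTwo)) 2 ∅) :=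
    isProbabilityMeasure_rcMeasure _ hp two_pos ∅
  constructor
  · by_cases hlink : AnnLink H In Ann
    · have hvol := forall_mem_of_annLink (φ := φ) le_rfl hρM hLA hδ4 hlink
      have key := hδ2 Λ hLA hvol
      calc min (min c₂ c₃) 1 ≤ c₂ := (min_le_left _ _).trans (min_le_left _ _)
        _ ≤ _ := key
        _ ≤ _ := measureReal_mono fun ω hω _ => hδ1 Λ ω hω
    · have huniv : {ω : BondConfig Λ | AnnPathSepG H In Ann ω} = univ :=
        eq_univ_of_forall fun ω hl => absurd hl hlink
      rw [huniv, probReal_univ]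
      exact min_le_right _ _
  · calc _ ≤ 1 - c₃ := hδ3 Λ hLA
      _ ≤ 1 - min (min c₂ c₃) 1 := by linarith [min_le_left (min c₂ c₃) 1, min_le_right c₂ c₃]

/-- **The registered stub from the two crossing bounds and the one ball-component lemma** (the
separation piece `AnnSideCrossSeparation` being proved, `annSideCrossSeparation`):
`ChartDiscOneComponent → HalfAnnulusSideCrossingBound → HalfAnnulusRimCrossingBound →
RoughHalfAnnulusRSWMeshOf AnnPathSepG`. The last two hypotheses are the instances of
Chelkak–Duminil-Copin–Hongler 2016 Thm 1.1 (named fact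
`Literature.Probability.LatticeModels.fkIsing_topologicalRectangle_crossingBounds`) for the discrete
rectangles carved out of the lattice conformal half-annulus.
[cite: ChelkakDuminilCopinHongler2016, Theorem 1.1 and Remark 2.2] -/
theorem roughHalfAnnulusRSWMesh_of_crossingBounds (h4 : ChartDiscOneComponent)
    (h2 : HalfAnnulusSideCrossingBound) (h3 : HalfAnnulusRimCrossingBound) :
    RoughHalfAnnulusRSWMeshOf AnnPathSepG :=
  roughHalfAnnulusRSWMesh_of_bounds annSideCrossSeparation h4 h2 h3

/-- The same, in closed form (registered sub-goal of stmt-CriticalPhenomena-10650): the wave-2 decomposition of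
`stub_roughHalfAnnulusRSWMesh` into the one-ball-component lemma and the two CDH16 Thm 1.1 instances. [folklore] -/
theorem roughHalfAnnulusRSWMesh_of_crossingBounds' : ChartDiscOneComponent → HalfAnnulusSideCrossingBound → HalfAnnulusRimCrossingBound → RoughHalfAnnulusRSWMeshOf AnnPathSepG :=
  roughHalfAnnulusRSWMesh_of_crossingBounds

end Summit.CriticalPhenomena.SAWScalingLimit.Theorems.IsingBoundaryRatio

end
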